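import Summits.ABC.ABC.Theorems.DefiniteXiDefiniteRTControlPrimeOfTakahashiLeaves
import Summits.ABC.ABC.Theorems.IsogenyGlueCongruenceMazurKenkuBoundLevelThirtyTwo
import Summits.ABC.ABC.Theorems.IsogenyGlueCongruenceMazurKenkuBoundLevelTwenty
import Literature.NumberTheory.EllipticCurves.RationalTwoTorsionModPIrreducibleProofs
import Literature.NumberTheory.EllipticCurves.KenkuMinimalLevels
import Literature.NumberTheory.EllipticCurves.PastenHeightBoundsLemma68LocalProofs
import HarnessLib

/-!
# Stub ideas k3 (gen 16) for `stub_pastenLemma68 : PastenShimura2024_lemma_6_8` — FAMILY 3, PROBE THE EXTREMES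

Companion of `STUB-IDEAS-stub_pastenLemma68-3.md` (crux `DefiniteXi.DefiniteRTControlPrime`, stmt-ABC-11338).

The extremal analysis of the ONE instance of Lemma 6.8 the skeleton consumes (`stub_valTransport`: Frey
source `E_(a,b)`, odd conductor prime `q`, constant `163`):

* certified (kit j345469, 15667 coprime triples): every cyclic `ℚ`-isogeny out of `E_(a,b)` has degree in
  `{1,2,3,4,6,8}`; the valuation ratio `c_q(W')/c_q(E)` at odd `q` is `u/d` with `ud ∣ 8` or `ud ∣ 6`; the
  constant `8` is ATTAINED (`1+15=16`, class `15a`, `q=3`: `c_3(E)=2`, `c_3(W')=16`);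
* certified (kit j345481, the `X₀(25)` family `j=(h²+250h+3125)³/h⁵`, `h=t⁵/(t⁴+5t³+15t²+25t+25)`): for a
  GENERAL source the sharp constant of Lemma 6.8 is `≥ 25` at odd multiplicative places (194 instances,
  e.g. `t=-11/3`, `N=185163`, `p=3`, valuations `(1,5,25)`), `= 25` granted Mazur–Kenku;
* the THEOREM behind the Frey value `8` (this file): full rational `2`-torsion doubles cyclic degrees
  (`SelfDouble`, `NeighbourDouble`), so the cyclic degrees out of a Frey curve are cut down to the divisors
  of `24` not divisible by `12` by EXACTLY the levels `20` (tree), `32` (tree), `24`, `36` (Ligozat 1975;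
  inside the named fact `kenku_minimalLevels_mem_kenkuDegrees`) and the prime-degree input
  `FreyPrimeDegreeLeThree` (`ℓ = 5`: tree; `ℓ = 7`: level `28`; `ℓ ≥ 11`: Mazur-type, irreducible core).

`lean check`: sorries ONLY in the helper stubs H1 `selfDouble`, H2 `neighbourDouble`, H5
`not_hasIrreducibleModPGaloisRep_of_prime_dvd_degree`; everything else (the
consumed-instance reshape `freyValTransport_of_radius`, the levels from the tree / from Kenku's named
fact, the arithmetic core, the ASSEMBLY `freyIsogenyRadius_eight_of` and `freyValTransport_eight_of`, and
the verbatim-stub closer pointer) is a real proof.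
-/

set_option linter.dupNamespace false
set_option linter.unusedVariables false

noncomputable section

open scoped Classical
open WeierstrassCurve IsDedekindDomain NumberField
open Literature.NumberTheory.EllipticCurves Literature.NumberTheory.EllipticCurves.ModularForms
open Summit.ABC.ABC.Theorems
open Summit.ABC.ABC.Theorems.DefiniteRTControlPrime

namespace Summit.ABC.ABC.Cruxes.DefiniteRTControlPrime.StubIdeas3G16

/-! ## 0. The verbatim stub: only closer is Mazur–Kenku (tree, k1/k2/k3 all gens) -/

/-- Pointer (PROVED in the tree): the verbatim stub from the Mazur–Kenku named fact. -/
theorem stub_verbatim_of_mazurKenku (h : mazurKenku_exists_cyclic_isogeny) :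
    PastenShimura2024_lemma_6_8 :=
  PastenShimura2024_lemma_6_8_of_mazurKenku' h

/-! ## 1. The consumed instance, with a constant `B` (`B = 163` is `stub_valTransport`'s conclusion) -/

/-- `v_q(Δ_min W') ≤ B · v_q(Δ_min E_(a,b))` for every `W'` isogenous to the Frey curve, `q` an odd
conductor prime. `FreyValTransport 163` is literally the conclusion of the skeleton's `stub_valTransport`. -/
def FreyValTransport (B : ℕ) : Prop :=
  ∀ (a b : ℤ), IsCoprime a b → a * b * (a + b) ≠ 0 → ∀ q : ℕ, q.Prime → q ≠ 2 →
    q ∣ (freyCurve a b).conductorNorm ℤ →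
    ∀ (W' : WeierstrassCurve ℚ) [W'.IsElliptic], (freyCurve a b).IsIsogenous W' →
      (W'.minimalDiscriminantNorm ℤ).factorization q ≤
        B * ((freyCurve a b).minimalDiscriminantNorm ℤ).factorization q

/-- (PROVED) radius `R` ⟹ transport constant `R` (the landed Mazur-free leg
`OfTakahashi.factorization_le_mul_of_isogeny`). -/
theorem freyValTransport_of_radius {R : ℕ} (h : OfTakahashi.FreyIsogenyRadius R) :
    FreyValTransport R := by
  intro a b hab h0 q hq hq2 hqN W' _ hiso
  obtain ⟨φ, hφ⟩ := h a b hab h0 q hq hq2 hqN W' hiso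
  exact OfTakahashi.factorization_le_mul_of_isogeny hab h0 hq hq2 hqN φ hφ

/-! ## 2. Full rational `2`-torsion doubles cyclic degrees (helpers H1, H2 — sorried, one cycle each) -/

/-- All of `E[2]` is pointwise `Γ_ℚ`-fixed (the tree's shape, as in
`hasIrreducibleModPGaloisRep_of_rational_two_torsion_of_degree_ne`). -/
def FullTwoTorsion (W : WeierstrassCurve ℚ) : Prop :=
  ∀ (σ : Field.absoluteGaloisGroup ℚ) (P : W.geomPoints), 2 • P = 0 → σ • P = P

/-- (PROVED, tree) Frey curves have full rational `2`-torsion. [cite: DarmonMerel1997, Lemma 1.2 (1)] -/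
theorem fullTwoTorsion_freyCurve {a b : ℤ} (h0 : a * b * (a + b) ≠ 0) :
    FullTwoTorsion (freyCurve a b) :=
  fun σ P hP ↦ smul_eq_of_two_nsmul_eq_zero_freyCurve h0 σ hP

/-- **H1 `SelfDouble` (M).** Full rational `2`-torsion and a cyclic isogeny of ODD degree `m` out of `W`
give a cyclic isogeny of degree `2m` out of `W` (kernel `ker ⊕ ⟨T⟩`, `T ∈ E[2](ℚ)`; quotient by
`exists_isogeny_ker_eq_and_comp_eq_nsmul_holds`). (= k3-g2 H5 with the full-`2`-torsion packaging.)
[cite: SilvermanAEC2009, Prop. III.4.12, Rem. III.4.13.2] -/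
def SelfDouble : Prop :=
  ∀ (W : WeierstrassCurve ℚ) [W.IsElliptic], FullTwoTorsion W →
    ∀ (W' : WeierstrassCurve ℚ) [W'.IsElliptic] (φ : Isogeny W W'), φ.IsCyclic → Odd φ.degree →
      ∃ (W₂ : WeierstrassCurve ℚ) (_ : W₂.IsElliptic) (χ : Isogeny W W₂),
        χ.IsCyclic ∧ χ.degree = 2 * φ.degree

theorem selfDouble : SelfDouble := by
  sorry

/-- **H2 `NeighbourDouble` (M, NEW).** Full rational `2`-torsion and a cyclic isogeny `φ` of ANY degree `n`
out of `W`: pick `T ∈ E[2] \ ker φ` (exists: `ker φ ∩ E[2]` is cyclic, so has order `≤ 2 < 4`), let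
`g : W → W₁ = W/⟨T⟩`; then `ĝ⁻¹(ker φ) ⊂ W₁` is `Γ_ℚ`-stable of order `2n` and CYCLIC, because
`ĝ(W₁[2]) = ⟨T⟩` meets `ker φ` trivially, so `ĝ⁻¹(ker φ) ∩ W₁[2] = ker ĝ` has order `2`.  Hence a cyclic
isogeny of degree `2n` out of the `2`-neighbour `W₁`.  (Generalises k3-g2 H6 = H1 + H2 for odd `n`, and
Steps 1–4 of the tree's `hasIrreducibleModPGaloisRep_of_rational_two_torsion_of_degree_ne`, `n = 2p`.)
[cite: DarmonMerel1997, Thm. 2.2 (proof)] [cite: SilvermanAEC2009, Prop. III.4.12, Thm. III.6.1] -/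
def NeighbourDouble : Prop :=
  ∀ (W : WeierstrassCurve ℚ) [W.IsElliptic], FullTwoTorsion W →
    ∀ (W' : WeierstrassCurve ℚ) [W'.IsElliptic] (φ : Isogeny W W'), φ.IsCyclic →
      ∃ (W₁ : WeierstrassCurve ℚ) (_ : W₁.IsElliptic) (W₂ : WeierstrassCurve ℚ) (_ : W₂.IsElliptic)
        (χ : Isogeny W₁ W₂), W.IsIsogenous W₁ ∧ χ.IsCyclic ∧ χ.degree = 2 * φ.degree

theorem neighbourDouble : NeighbourDouble := by
  sorry

/-! ## 3. The finite modular budget: levels `20`, `32` (tree), `24`, `36`, `28` (named targets) -/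

/-- No cyclic `ℚ`-isogeny of degree `n` between elliptic curves over `ℚ` (`Y₀(n)(ℚ) = ∅`). -/
def NoCyclicIsogenyOfDegree (n : ℕ) : Prop :=
  ∀ (W₁ W₂ : WeierstrassCurve ℚ) [W₁.IsElliptic] [W₂.IsElliptic] (φ : Isogeny W₁ W₂),
    φ.IsCyclic → φ.degree ≠ n

/-- (PROVED, tree: `isogeny_isCyclic_degree_ne_twenty_holds`, Kubert/Kenku). -/
theorem noCyclic_twenty : NoCyclicIsogenyOfDegree 20 :=
  fun W₁ W₂ _ _ φ hφ ↦ isogeny_isCyclic_degree_ne_twenty_holds W₁ W₂ φ hφ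

/-- (PROVED, tree: `isogeny_isCyclic_degree_ne_thirtyTwo`, Ligozat/Kenku). -/
theorem noCyclic_thirtyTwo : NoCyclicIsogenyOfDegree 32 :=
  fun W₁ W₂ _ _ φ hφ ↦ isogeny_isCyclic_degree_ne_thirtyTwo φ hφ

/-- (PROVED) the three new levels are instances of the tree's NAMED fact (Kenku's 84 minimal levels);
unconditionally they are Ligozat 1975 (`X₀(24)`, `X₀(36)`: genus `1`, rank `0`, rational points = cusps)
and Kenku (`X₀(28)`, genus `2`). [cite: Ligozat1975] [cite: Kenku1982, Thm. 1 (list of levels)] -/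
theorem noCyclic_of_kenku (hK : kenku_minimalLevels_mem_kenkuDegrees) :
    NoCyclicIsogenyOfDegree 24 ∧ NoCyclicIsogenyOfDegree 28 ∧ NoCyclicIsogenyOfDegree 36 := by
  refine ⟨fun W₁ W₂ _ _ φ hφ h ↦ ?_, fun W₁ W₂ _ _ φ hφ h ↦ ?_, fun W₁ W₂ _ _ φ hφ h ↦ ?_⟩ <;>
  · have hmem := isCyclic_degree_not_mem_minimalLevels_of_kenku hK φ hφ
    rw [h] at hmem
    simp at hmem

/-! ## 4. The prime-degree input (the irreducible Mazur-type core, isolated) -/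

/-- **H4 `FreyPrimeDegreeLeThree`.** A cyclic `ℚ`-isogeny of PRIME degree out of a Frey curve has degree
`2` or `3`; stated WITH the crux's odd conductor prime `q` in scope (the one Frey curve without an odd bad
prime, `1+1=2`, `j=1728`, is outside the crux and outside `FreyIsogenyRadius`), so that Mazur's Cor. 4.4 at
the odd multiplicative place applies.  `ℓ = 5`: tree (`hasIrreducibleModPGaloisRep_of_rational_two_torsion_of_degree_ne` + level
`20` + H5, `not_five_dvd_degree_freyCurve`); `ℓ = 7`: H1 + H2 + level `28` (`not_seven_dvd_degree_freyCurve`), or `mazur_torsion`; `ℓ = 13`: H1 + level `26` (tree, mod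
Klein–Fricke `13`); `ℓ = 11, ≥ 17`: Mazur 1978 Cor. 4.4 at the odd multiplicative place (named fact
`Mazur1978.cor44_valuation_j_le_one`, k3-g2 H1) OR `hasIrreducibleModPGaloisRep_freyCurve_of_mazur_torsion`
(tree, normalised triples `A ≡ -1 (4)`, `4 ∣ B`; gap `v₂(B) = 1`: Swan conductor `3`, odd, then
`exists_swanConductorAt_torsion_eq_two_mul_of_not_hasIrreducibleModPGaloisRep`).
[cite: Mazur1978, Cor. 4.4] [cite: Ribet1997, Prop. 1] [cite: DiamondKramer1995, Lemma 3] -/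
def FreyPrimeDegreeLeThree : Prop :=
  ∀ (a b : ℤ), IsCoprime a b → a * b * (a + b) ≠ 0 → ∀ q : ℕ, q.Prime → q ≠ 2 →
    q ∣ (freyCurve a b).conductorNorm ℤ →
    ∀ (W' : WeierstrassCurve ℚ) [W'.IsElliptic] (φ : Isogeny (freyCurve a b) W'),
      φ.IsCyclic → φ.degree.Prime → φ.degree ≤ 3

/-- **H5 (S).** A prime dividing the degree of a CYCLIC isogeny out of `W` makes `ρ̄_{W,p}` reducible
(`ker φ ∩ W[p]` is a stable line; body = the tree's `mem_mazurPrimes_of_prime_dvd_degree` up to its use of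
`mazur_isogeny_irreducible`; = k1-g5 A′1a). [cite: SilvermanAEC2009, Prop. III.4.12] -/
theorem not_hasIrreducibleModPGaloisRep_of_prime_dvd_degree {W W' : WeierstrassCurve ℚ}
    [W.IsElliptic] [W'.IsElliptic] (φ : Isogeny W W') (hφ : φ.IsCyclic) {p : ℕ} (hp : p.Prime)
    (hpd : p ∣ φ.degree) : ¬ W.HasIrreducibleModPGaloisRep p := by
  sorry

/-- The Darmon–Merel road through `X₀(4p)`, in the shape of the LANDED tree theorem
`Summit.ABC.ABC.Theorems.hasIrreducibleModPGaloisRep_of_rational_two_torsion_of_degree_ne`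
(`Theorems/DefiniteXiFreyModularityStubDegreeNeTwenty.lean`; taken here as a hypothesis only because that
module is not yet in the farm snapshot this session — it is PROVED in the tree). -/
def DarmonMerelRoad : Prop :=
  ∀ (W : WeierstrassCurve ℚ) [W.IsElliptic], FullTwoTorsion W →
    ∀ {p : ℕ}, p.Prime → p ≠ 2 →
      (∀ (W₁ W₂ : WeierstrassCurve ℚ) [W₁.IsElliptic] [W₂.IsElliptic] (φ : Isogeny W₁ W₂),
        φ.IsCyclic → φ.degree ≠ 4 * p) →
      W.HasIrreducibleModPGaloisRep p

/-- (PROVED over H5 + tree) the `ℓ = 5` slice of H4: no cyclic isogeny out of a Frey curve has degree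
divisible by `5` (Darmon–Merel road through `X₀(20)`; level `20` is the tree's
`isogeny_isCyclic_degree_ne_twenty_holds`). -/
theorem not_five_dvd_degree_freyCurve (hDM : DarmonMerelRoad) {a b : ℤ} (h0 : a * b * (a + b) ≠ 0)
    {W' : WeierstrassCurve ℚ} [W'.IsElliptic] (φ : Isogeny (freyCurve a b) W') (hφ : φ.IsCyclic) :
    ¬ 5 ∣ φ.degree := by
  haveI := isElliptic_freyCurve h0
  intro h5
  have hirr : (freyCurve a b).HasIrreducibleModPGaloisRep 5 :=
    hDM (freyCurve a b) (fullTwoTorsion_freyCurve h0) Nat.prime_five (by norm_num)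
      (fun W₁ W₂ _ _ ψ hψ ↦ isogeny_isCyclic_degree_ne_twenty_holds W₁ W₂ ψ hψ)
  exact not_hasIrreducibleModPGaloisRep_of_prime_dvd_degree φ hφ Nat.prime_five h5 hirr

/-- (PROVED over H5 + H1 + H2 + a level) the same road one prime up: `ℓ = 7` from level `28`
(`7 ↦ 14` on `E` by H1, `14 ↦ 28` next door by H2). -/
theorem not_seven_dvd_degree_freyCurve (hS : SelfDouble) (hN : NeighbourDouble)
    (h28 : NoCyclicIsogenyOfDegree 28) {a b : ℤ} (h0 : a * b * (a + b) ≠ 0)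
    {W' : WeierstrassCurve ℚ} [W'.IsElliptic] (φ : Isogeny (freyCurve a b) W') (hφ : φ.IsCyclic) :
    ¬ 7 ∣ φ.degree := by
  haveI := isElliptic_freyCurve h0
  intro h7
  obtain ⟨W'', hW'', χ, hχ, hdeg, -⟩ := φ.exists_isCyclic_degree_eq_of_dvd hφ h7
  haveI := hW''
  obtain ⟨W₂, hW₂, χ', hχ', hdeg'⟩ :=
    hS (freyCurve a b) (fullTwoTorsion_freyCurve h0) W'' χ hχ (by rw [hdeg]; decide)
  haveI := hW₂
  obtain ⟨W₁, hW₁, W₃, hW₃, ξ, -, hξ, hξdeg⟩ :=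
    hN (freyCurve a b) (fullTwoTorsion_freyCurve h0) W₂ χ' hχ'
  haveI := hW₁; haveI := hW₃
  exact h28 W₁ W₃ ξ hξ (by rw [hξdeg, hdeg', hdeg])

/-! ## 5. The arithmetic core (PROVED) -/

/-- Divisors of `24` not divisible by `12` are `≤ 8` (they are `1,2,3,4,6,8`). -/
theorem le_eight_of_dvd_twentyFour {n : ℕ} (h24 : n ∣ 24) (h12 : ¬ 12 ∣ n) : n ≤ 8 := by
  have hle : n ≤ 24 := Nat.le_of_dvd (by norm_num) h24
  interval_cases n <;> omega

/-- Prime support `⊆ {2,3}`, `16 ∤ n`, `9 ∤ n` ⟹ `n ∣ 24`. -/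
theorem dvd_twentyFour_of_primeSupport {n : ℕ} (hn : 0 < n)
    (hps : ∀ p : ℕ, p.Prime → p ∣ n → p = 2 ∨ p = 3) (h16 : ¬ 16 ∣ n) (h9 : ¬ 9 ∣ n) :
    n ∣ 24 := by
  -- `n = 2^a · m`, `m` odd with prime support `⊆ {3}`, so `m = 3^b`; `a ≤ 3`, `b ≤ 1`.
  obtain ⟨a, m, hm, rfl⟩ := Nat.exists_eq_two_pow_mul_odd hn.ne'
  have hm0 : m ≠ 0 := by rintro rfl; simp at hm
  have hm3 : m = 3 ^ m.primeFactorsList.length := by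
    refine Nat.eq_prime_pow_of_unique_prime_dvd hm0 (fun {d} hd hdm ↦ ?_)
    rcases hps d hd (hdm.mul_left _) with rfl | rfl
    · exact absurd hdm (hm.not_two_dvd_nat)
    · rfl
  set b := m.primeFactorsList.length with hb
  have ha : a ≤ 3 := by
    by_contra ha
    apply h16
    have : 2 ^ 4 ∣ 2 ^ a := Nat.pow_dvd_pow 2 (by omega)
    exact (this.mul_right m)
  have hb1 : b ≤ 1 := by
    by_contra hb1
    apply h9
    have : 3 ^ 2 ∣ 3 ^ b := Nat.pow_dvd_pow 3 (by omega)
    rw [hm3]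
    exact this.mul_left _
  rw [hm3, show (24 : ℕ) = 2 ^ 3 * 3 ^ 1 by norm_num]
  exact Nat.mul_dvd_mul (Nat.pow_dvd_pow 2 ha) (Nat.pow_dvd_pow 3 hb1)

/-! ## 6. ASSEMBLY (PROVED from H1, H2, levels 24/36, H4): the sharp Frey radius `8` and transport `8` -/

/-- **The cyclic degrees out of a Frey curve are `≤ 8`** (in fact `∈ {1,2,3,4,6,8}`), from the doubling
helpers, the levels `20, 32` (tree) and `24, 36`, and the prime-degree input. -/
theorem cyclic_degree_le_eight_of (hS : SelfDouble) (hN : NeighbourDouble)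
    (h24 : NoCyclicIsogenyOfDegree 24) (h36 : NoCyclicIsogenyOfDegree 36)
    (hP : FreyPrimeDegreeLeThree) {a b : ℤ} (hab : IsCoprime a b) (h0 : a * b * (a + b) ≠ 0)
    {q : ℕ} (hq : q.Prime) (hq2 : q ≠ 2) (hqN : q ∣ (freyCurve a b).conductorNorm ℤ)
    {W' : WeierstrassCurve ℚ} [W'.IsElliptic] (ψ : Isogeny (freyCurve a b) W') (hψ : ψ.IsCyclic) :
    ψ.degree ≤ 8 := by
  haveI := isElliptic_freyCurve h0
  have h2t : FullTwoTorsion (freyCurve a b) := fullTwoTorsion_freyCurve h0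
  -- (i) prime support ⊆ {2,3}
  have hps : ∀ p : ℕ, p.Prime → p ∣ ψ.degree → p = 2 ∨ p = 3 := by
    intro p hp hpd
    obtain ⟨W'', hW'', χ, hχ, hdeg, -⟩ := ψ.exists_isCyclic_degree_eq_of_dvd hψ hpd
    haveI := hW''
    have hle : χ.degree ≤ 3 := hP a b hab h0 q hq hq2 hqN W'' χ hχ (hdeg ▸ hp)
    have h2le : 2 ≤ p := hp.two_le
    rw [hdeg] at hle
    interval_cases p <;> simp_all
  -- (ii) 16 ∤ deg : else a cyclic 16 out of E, hence a cyclic 32 next door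
  have h16 : ¬ 16 ∣ ψ.degree := by
    intro h
    obtain ⟨W'', hW'', χ, hχ, hdeg, -⟩ := ψ.exists_isCyclic_degree_eq_of_dvd hψ h
    haveI := hW''
    obtain ⟨W₁, hW₁, W₂, hW₂, ξ, -, hξ, hξdeg⟩ := hN (freyCurve a b) h2t W'' χ hχ
    haveI := hW₁; haveI := hW₂
    exact noCyclic_thirtyTwo W₁ W₂ ξ hξ (by rw [hξdeg, hdeg])
  -- (iii) 9 ∤ deg : else cyclic 9 out of E, cyclic 18 out of E (H1), cyclic 36 next door (H2)
  have h9 : ¬ 9 ∣ ψ.degree := by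
    intro h
    obtain ⟨W'', hW'', χ, hχ, hdeg, -⟩ := ψ.exists_isCyclic_degree_eq_of_dvd hψ h
    haveI := hW''
    obtain ⟨W₂, hW₂, χ', hχ', hdeg'⟩ := hS (freyCurve a b) h2t W'' χ hχ (by rw [hdeg]; decide)
    haveI := hW₂
    obtain ⟨W₁, hW₁, W₃, hW₃, ξ, -, hξ, hξdeg⟩ := hN (freyCurve a b) h2t W₂ χ' hχ'
    haveI := hW₁; haveI := hW₃
    exact h36 W₁ W₃ ξ hξ (by rw [hξdeg, hdeg', hdeg])
  -- (iv) 12 ∤ deg : else cyclic 12 out of E, cyclic 24 next door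
  have h12 : ¬ 12 ∣ ψ.degree := by
    intro h
    obtain ⟨W'', hW'', χ, hχ, hdeg, -⟩ := ψ.exists_isCyclic_degree_eq_of_dvd hψ h
    haveI := hW''
    obtain ⟨W₁, hW₁, W₂, hW₂, ξ, -, hξ, hξdeg⟩ := hN (freyCurve a b) h2t W'' χ hχ
    haveI := hW₁; haveI := hW₂
    exact h24 W₁ W₂ ξ hξ (by rw [hξdeg, hdeg])
  -- (v) arithmetic
  exact le_eight_of_dvd_twentyFour (dvd_twentyFour_of_primeSupport ψ.degree_pos hps h16 h9) h12

/-- **`FreyIsogenyRadius 8`** (the landed leaf `OfTakahashi.FreyIsogenyRadius`, SHARP: class `15a`). -/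
theorem freyIsogenyRadius_eight_of (hS : SelfDouble) (hN : NeighbourDouble)
    (h24 : NoCyclicIsogenyOfDegree 24) (h36 : NoCyclicIsogenyOfDegree 36)
    (hP : FreyPrimeDegreeLeThree) : OfTakahashi.FreyIsogenyRadius 8 := by
  intro a b hab h0 q hq hq2 hqN W' _ hiso
  haveI := isElliptic_freyCurve h0
  obtain ⟨ψ, hψ⟩ := hiso.exists_isCyclic
  exact ⟨ψ, cyclic_degree_le_eight_of hS hN h24 h36 hP hab h0 hq hq2 hqN ψ hψ⟩

/-- **`FreyValTransport 8`**: the consumed instance of Lemma 6.8 with `163 ↦ 8` (sharp: `1+15=16`, `q=3`). -/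
theorem freyValTransport_eight_of (hS : SelfDouble) (hN : NeighbourDouble)
    (h24 : NoCyclicIsogenyOfDegree 24) (h36 : NoCyclicIsogenyOfDegree 36)
    (hP : FreyPrimeDegreeLeThree) : FreyValTransport 8 :=
  freyValTransport_of_radius (freyIsogenyRadius_eight_of hS hN h24 h36 hP)

/-- … and with the levels taken from Kenku's named fact (trust base: H1, H2, H4 + ONE named fact). -/
theorem freyValTransport_eight_of_kenku (hS : SelfDouble) (hN : NeighbourDouble)
    (hK : kenku_minimalLevels_mem_kenkuDegrees) (hP : FreyPrimeDegreeLeThree) : FreyValTransport 8 :=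
  freyValTransport_eight_of hS hN (noCyclic_of_kenku hK).1 (noCyclic_of_kenku hK).2.2 hP

end Summit.ABC.ABC.Cruxes.DefiniteRTControlPrime.StubIdeas3G16

end
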